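import Summits.Langlands.Langlands.Theorems.IrreducibilityBySelfDualityReciprocityUpToIrreducibilityRankOneUnramified
import Literature.NumberTheory.Automorphic.CarayolCompatibilityOfLocalGlobalProofs
import HarnessLib

/-!
# Line `Sketch` for the crux `ReciprocityUpToIrreducibility` (item stmt-Langlands-14328), continuation c5:
# rank `n` — the Galois side of the unramified matching (stub H2 `stub_transport_frobCharpoly`)

Support file (closes nothing; continuation lead c5, prover-line-stmt-Langlands-14328-c5-0).

On the unramified-at-`v` sector the summit's local–global clause is the ℓ-blind matching
`rec_v(π_v) = [ι(ρ|_{W_{K_v}}, 0)^{F-ss}]`.  This file is the GALOIS side in rank `n`: if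
`ρ : Γ_K → GL_n(ℚ̄_ℓ)` is unramified at `v` with arithmetic-Frobenius characteristic polynomial
`arithFrobPolyOfSatake ι q_v 1 α = ∏_{a ∈ α} (X - ι⁻¹(a⁻¹))` (the Satake clause), then every transport
`rℂ` of `(ρ|_{W_{K_v}}, N = 0)` along `ι` has `N = 0`, is trivial on inertia, and every GEOMETRIC
Frobenius `Φ ∈ W_{K_v}` (`deg Φ = -1`) has `char(rℂ.ρ Φ) = ∏_{a ∈ α} (X - a)`
(`transport_frobCharpoly`, registered stub `stub_transport_frobCharpoly`; rank-one template: c4's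
`rankOne_transport_frobenius`).  No definitions; std axioms.
-/

noncomputable section

set_option linter.dupNamespace false -- project-wide option (lakefile weak.linter.dupNamespace); `Summit.Langlands.Langlands` is the mandated namespace

open scoped MatrixGroups Matrix NumberField Classical Polynomial
open Filter IsDedekindDomain Field Polynomial
open Literature.NumberTheory.Automorphic Literature.NumberTheory.GaloisRepresentations
open Literature.NumberTheory.PAdicHodge
open Summit.Langlands
open Summit.Langlands.Langlands.Theorems.VarmaWeilTracesUnramified

namespace Summit.Langlands.Langlands.Theorems.ReciprocityUpToIrreducibility

section RankN

variable {K : Type} [Field K] [NumberField K] {ℓ : ℕ} [Fact ℓ.Prime] {n : ℕ}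

/-- **Charpoly of a geometric Frobenius under an unramified `ρ|_{Γ_{K_v}}`.**  Let
`ρ : Γ_K → GL_n(ℚ̄_ℓ)` be unramified at `v` with arithmetic-Frobenius characteristic polynomial
`∏_{a ∈ α} (X - ι⁻¹(a⁻¹))` at `v`.  Then every `σ ∈ Γ_{K_v}` of Frobenius degree `-1` (a geometric
Frobenius) has `char(ρ(σ)) = ∏_{a ∈ α} (X - ι⁻¹(a))`: `σ · φ` is inertial for a local arithmetic
Frobenius `φ` (`exists_isAbsArithFrob_holds`, `IsFrobPow.mul_inv_mem_absInertia_holds`), `ρ|_{Γ_{K_v}}`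
kills inertia (`isLocallyUnramified_toLocal_of_isUnramifiedAt`), the restriction of `φ` is an
arithmetic Frobenius at the prime cut out by the completion
(`isArithFrobAt_absGaloisRestrict_adicCompletionPrime_iff`), and `char(M⁻¹) = ∏ (X - b⁻¹)`
(`charpoly_inv_of_charpoly_eq_prod`). [cite: TateCorvallis1979, (4.1.3)–(4.2.1)]
[cite: SerreAbelianLadic1968, Ch. I §2.1] -/
theorem charpoly_toLocal_of_isFrobPow_neg_one (ι : PadicAlgCl ℓ ≃+* ℂ)
    (ρ : FramedGaloisRep K (PadicAlgCl ℓ) n) (v : HeightOneSpectrum (𝓞 K)) (hρ : ρ.IsUnramifiedAt v)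
    (α : Multiset ℂ) (hfrob : ρ.HasFrobCharpolyAt v (arithFrobPolyOfSatake ι v.residueCard 1 α))
    (σ : absoluteGaloisGroup (v.adicCompletion K)) (hσ : IsFrobPow σ (-1)) :
    (((ρ.toLocal v) σ : GL (Fin n) (PadicAlgCl ℓ)) : Matrix (Fin n) (Fin n) (PadicAlgCl ℓ)).charpoly =
      (α.map fun a => X - C (ι.symm a)).prod := by
  classical
  -- a local arithmetic Frobenius `φ`; `σ φ` is inertial, hence killed by `ρ|_{Γ_{K_v}}`
  obtain ⟨φ, hφ⟩ := exists_isAbsArithFrob_holds (v.adicCompletion K)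
  have h1 : IsFrobPow φ 1 := IsAbsArithFrob.isFrobPow_holds hφ
  have hin : σ * φ ∈ absInertia (v.adicCompletion K) := by
    simpa using IsFrobPow.mul_inv_mem_absInertia_holds hσ h1.inv
  have hker : ρ.toLocal v (σ * φ) = 1 :=
    isLocallyUnramified_toLocal_of_isUnramifiedAt ρ v hρ _ hin
  have hσeq : ρ.toLocal v σ = (ρ.toLocal v φ)⁻¹ :=
    eq_inv_of_mul_eq_one_left (by rwa [map_mul] at hker)
  -- the restriction of `φ` is an arithmetic Frobenius at `𝔓₀`, so `charpoly ρ(φ) = ∏ (X - ι⁻¹(a⁻¹))`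
  have hqN : IsNonarchimedeanLocalField.residueFieldCard (v.adicCompletion K) = Nat.card (𝓞 K ⧸ v.asIdeal) :=
    (residueFieldCard_adicCompletion_eq K v).trans (HeightOneSpectrum.residueCard_eq_card_quotient v)
  have hF : IsArithFrobAt (𝓞 K) (absGaloisRestrict K (v.adicCompletion K) φ)
      (adicCompletionPrime K v) :=
    (isArithFrobAt_absGaloisRestrict_adicCompletionPrime_iff K v hqN φ).mpr hφ
  have hM : (((ρ.toLocal v φ : GL (Fin n) (PadicAlgCl ℓ))) :
      Matrix (Fin n) (Fin n) (PadicAlgCl ℓ)).charpoly =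
        ((α.map fun a => ι.symm a⁻¹).map fun b => X - C b).prod := by
    rw [Multiset.map_map]
    have h := hfrob _ (adicCompletionPrime_mem_primesAbove K v) _ hF
    rw [arithFrobPolyOfSatake_one] at h
    exact h
  rw [hσeq, Matrix.coe_units_inv,
    Summit.Langlands.Langlands.Cruxes.MuOrdinaryFamilyRT.CharZeroDominance.charpoly_inv_of_charpoly_eq_prod
      (Units.isUnit _) hM, Multiset.map_map]
  refine congrArg _ (Multiset.map_congr rfl fun a _ => ?_)
  simp only [Function.comp_apply, map_inv₀, inv_inv]

/-- **Rank `n`, Galois side of the unramified matching.**  Let `ρ : Γ_K → GL_n(ℚ̄_ℓ)` be unramified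
at `v` with arithmetic-Frobenius characteristic polynomial `arithFrobPolyOfSatake ι q_v 1 α =
∏_{a ∈ α} (X - ι⁻¹(a⁻¹))` (the Satake clause).  Then every transport `rℂ` of `(ρ|_{W_{K_v}}, N = 0)`
along `ι` has `N = 0`, is trivial on inertia, and every GEOMETRIC Frobenius `Φ` (`deg Φ = -1`) has
`char(rℂ.ρ Φ) = ∏_{a ∈ α} (X - a)`: the restriction of `Φ` to `Γ_{K_v}` has Frobenius degree `-1`
(`WeilGroup.isFrobPow_deg`), so `char(ρ(Φ)) = ∏ (X - ι⁻¹(a))`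
(`charpoly_toLocal_of_isFrobPow_neg_one`), and the transport is entrywise `ι`
(`toMatrix'_weilRestrict`, `Matrix.charpoly_map`). [cite: TateCorvallis1979, (4.1.3)–(4.2.1)]
[cite: BuzzardGeeLMS2014, Rem. 3.2.5] [cite: SerreAbelianLadic1968, Ch. I §2.1] -/
theorem transport_frobCharpoly (ι : PadicAlgCl ℓ ≃+* ℂ) (ρ : FramedGaloisRep K (PadicAlgCl ℓ) n)
    (v : HeightOneSpectrum (𝓞 K)) (hρ : ρ.IsUnramifiedAt v) (α : Multiset ℂ)
    (hfrob : ρ.HasFrobCharpolyAt v (arithFrobPolyOfSatake ι v.residueCard 1 α))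
    (rℂ : WeilDeligneRep (v.adicCompletion K) ℂ (Fin n → ℂ))
    (htr : (WeilDeligneRep.ofRep ((ρ.toLocal v).weilRestrict (v.adicCompletion K))
      (isLocallyUnramified_toLocal_of_isUnramifiedAt ρ v hρ).isUnramifiedRep_weilRestrict.isContinuousRep).IsTransportAlong
        (ι : PadicAlgCl ℓ →+* ℂ) rℂ) :
    rℂ.N = 0 ∧ WeilGroup.IsUnramifiedRep rℂ.ρ ∧
      ∀ Φ : WeilGroup (v.adicCompletion K), WeilGroup.deg Φ = -1 →
        (rℂ.ρ Φ).charpoly = (α.map fun a => X - C a).prod := by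
  refine ⟨htr.N_eq_zero (WeilDeligneRep.ofRep_N _ _),
    htr.isUnramifiedRep
      (isLocallyUnramified_toLocal_of_isUnramifiedAt ρ v hρ).isUnramifiedRep_weilRestrict, fun Φ hΦ => ?_⟩
  have hdeg : IsFrobPow (WeilGroup.toAbsGalois (v.adicCompletion K) Φ) (-1) := by
    simpa [hΦ] using WeilGroup.isFrobPow_deg IsFrobPow.mul_holds Φ
  have hch := charpoly_toLocal_of_isFrobPow_neg_one ι ρ v hρ α hfrob
    (WeilGroup.toAbsGalois (v.adicCompletion K) Φ) hdeg
  -- the matrix of `rℂ.ρ Φ` is the `ι`-image of that of `ρ(Φ)`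
  have hmat := htr.1 Φ
  rw [WeilDeligneRep.ofRep_ρ, toMatrix'_weilRestrict, FramedRep.toWeilGroupHom_apply] at hmat
  rw [charpoly_eq_charpoly_toMatrix', hmat, Matrix.charpoly_map, hch, Polynomial.map_multiset_prod,
    Multiset.map_map]
  refine congrArg _ (Multiset.map_congr rfl fun a _ => ?_)
  simp only [Function.comp_apply, Polynomial.map_sub, Polynomial.map_X, Polynomial.map_C,
    RingHom.coe_coe, RingEquiv.apply_symm_apply]

/-- **Registered stub `stub_transport_frobCharpoly` (H2) of line `Sketch` (crux stmt-Langlands-14328),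
closed form of `transport_frobCharpoly`**: the Galois side of the rank-`n` unramified matching —
every transport of `(ρ|_{W_{K_v}}, 0)` along `ι` has `N = 0`, is unramified, and its geometric
Frobenii have characteristic polynomial `∏_{a ∈ α} (X - a)` when `ρ` is unramified at `v` with the
Satake clause `char(ρ(Frob_v^{arith})) = arithFrobPolyOfSatake ι q_v 1 α`.
[cite: TateCorvallis1979, (4.1.3)–(4.2.1)] [cite: BuzzardGeeLMS2014, Rem. 3.2.5]
[cite: SerreAbelianLadic1968, Ch. I §2.1] -/
theorem stub_transport_frobCharpoly :
    ∀ (K : Type) [Field K] [NumberField K] (ℓ : ℕ) [Fact ℓ.Prime] (n : ℕ) (ι : PadicAlgCl ℓ ≃+* ℂ)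
      (ρ : FramedGaloisRep K (PadicAlgCl ℓ) n) (v : HeightOneSpectrum (𝓞 K)) (hρ : ρ.IsUnramifiedAt v)
      (α : Multiset ℂ), ρ.HasFrobCharpolyAt v (arithFrobPolyOfSatake ι v.residueCard 1 α) →
      ∀ (rℂ : WeilDeligneRep (v.adicCompletion K) ℂ (Fin n → ℂ)),
        (WeilDeligneRep.ofRep ((ρ.toLocal v).weilRestrict (v.adicCompletion K))
          (isLocallyUnramified_toLocal_of_isUnramifiedAt ρ v hρ).isUnramifiedRep_weilRestrict.isContinuousRep).IsTransportAlong
            (ι : PadicAlgCl ℓ →+* ℂ) rℂ →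
        rℂ.N = 0 ∧ WeilGroup.IsUnramifiedRep rℂ.ρ ∧
          ∀ Φ : WeilGroup (v.adicCompletion K), WeilGroup.deg Φ = -1 →
            (rℂ.ρ Φ).charpoly = (α.map fun a => X - C a).prod :=
  fun _ _ _ _ _ _ ι ρ v hρ α hfrob rℂ htr => transport_frobCharpoly ι ρ v hρ α hfrob rℂ htr

end RankN

end Summit.Langlands.Langlands.Theorems.ReciprocityUpToIrreducibility

end
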